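import Summits.AtomisticToContinuum.Crystallization.Theorems.FrustratedLawDichotomyStrainedPatchQuantSlaving
import Summits.AtomisticToContinuum.Crystallization.Theorems.FrustratedLawDichotomyNashForceBalance

/-!
# «ForceCap» — (FC σ₁) PROVED: every reach site of an admissible cluster is force-capped, `‖siteForce 7 z a‖ ≤ σ₁`
# (27623 strained-patch piece, T-side [CORE-FAR]; decomp-a2c lens-5 «finite range + asymptotic regime + bridge», generation 58; critic row 1059 (c))

(Imports lens-5 g57 `…StrainedPatchQuantSlaving` (the typed force cap `ForceCapLaw σ` / `ForceCapOne`, `moveNbrs`, `locField`, `siteForce`, `IsReach`,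
the records `coreOff_record_g57c ηP k n` / `slavingEnclosure_of_forceCap` / `remainderStep_of_forceCap` whose FIRST binder is `(hFC : ForceCapOne)`) and the
tree's `…NashForceBalance` (`hasFDerivAt_lennardJones_dist`, the gradient of one Lennard-Jones term).)

THE TWO THEOREMS (both CLOSED here; 0 sorry).
* ★ **(FMC) `finiteMoveCap`** — the FINITE-MOVE CAP, by literal unfolding of non-exemption: at a reach site `a` of an admissible cluster, for every `s ∈ [0, 3/2]`
  and every trial point `p` with `dist p (z a) ≤ s`, `dist p (z a) < 7/10`:
  `locField 7 z a (z a) ≤ locField 7 z a p + s·(7/(7−s))⁷·σ₁`.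
  (`Admissible ⊇ ¬ExemptNear (9/5) ExRec`, `ExRec = Collar (9/2) ((∃ s ∈ [0,3/2], NonEquilibriumCore (−0.7175) 0 7 s 10⁻⁴) ∨ …)`,
  `NonEquilibriumCore ⊇ MoveUnstableCore 0 7 s`, and `MoveUnstableCore 0 7 s` at `a` IS `∃ p, dist p (z a) ≤ s ∧ dist p (z a) < 7/10 ∧ locField 7 z a p + (0 + s·(7/(7−s))⁷·σ₁) <
  locField 7 z a (z a)` — `locField`, `moveNbrs`, `sigmaOne` are definitionally the sums / the constant inside the tree's `MoveUnstableCore`.)  This is the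
  GLOBAL (finite-`s`) form of the cap; (FC) is its `s → 0⁺` slope, and (FMC) is strictly MORE than (FC) (it also caps finite excursions up to `7/10`, which is what a
  cage-localisation argument «(CAGE d₀)» consumes).
* ★★ **(FC σ₁) `forceCapOne : ForceCapOne`** — the `s → 0⁺` limit: `locField 7 z a` is Fréchet-differentiable at `z a` with derivative `⟨w, ·⟩`,
  `w = Σ_{k ∈ moveNbrs} (V'(r_ak)/r_ak)·(z a − z k) = −siteForce 7 z a` (injectivity of `z` makes every summand `lennardJones (dist · (z k))` smooth at `z a`;
  `V'(r)/r = r⁻⁸ − r⁻¹⁴ = ljD1 r / r`); along `p = z a − t·v` (`‖v‖ = 1`, `t → 0⁺`) (FMC) gives `t·⟨w, v⟩ ≤ t·(7/(7−t))⁷·σ₁ + o(t)`, hence `⟨w, v⟩ ≤ σ₁` for every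
  unit `v`, hence `‖w‖ ≤ σ₁` (`v = w/‖w‖`).  Consequences in the tree of record: `forceCapLaw_of_le` — (FC σ) for every `σ ≥ σ₁`; the g57 records
  `coreOff_record_g57c`, `slavingEnclosure_of_forceCap`, `remainderStep_of_forceCap` lose their `(hFC : ForceCapOne)` binder (`coreOff_record_g58c`,
  `slavingEnclosure_of_taylor`, `remainderStep_of_taylorIn` below).

STRENGTH TAGS (doctrine (a)).  (FMC), (FC σ₁): TRUE · PROVED (known mathematics: one-sided directional derivative of a finite sum of smooth pair terms at a
constrained minimum of the move test; no literature input).  WHY WEAKER THAN THE TARGET: (FC) is one first-order consequence of non-exemption at move tolerance `0`;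
it says nothing about second-order stability, removal stability, cleanness or the far field, and holds verbatim for every non-exempt configuration whether or
not [CORE-FAR] does.  WHY NOVEL (for the cell): the first MECHANICAL fact about admissible clusters landed as a theorem — every (ENC)/(STEP)/(CAGE) piece of the
«QuantSlaving» architecture starts from it, and the census's force-polytope instruments (O1)–(O4) are now instruments about a PROVED enclosure `|F| ≤ σ₁` rather than
an assumed one.  No `sorry`, no new axiom, no `instance`, no `notation`.
-/

namespace Summit.AtomisticToContinuum.Crystallization.Theorems.FrustratedLawDichotomyStrainedPatchForceCap

open scoped BigOperators
open Filter Topology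
open Literature.MathematicalPhysics.StatisticalMechanics (lennardJones)
open Summit.AtomisticToContinuum.Crystallization.Theorems.FrustratedLawDichotomyPeriodicBlockFlags (goodAtScale_mono)
open Summit.AtomisticToContinuum.Crystallization.Theorems.FrustratedLawDichotomyRangeCut (Sep)
open Summit.AtomisticToContinuum.Crystallization.Theorems.FrustratedLawDichotomyMotifLemmas
open Summit.AtomisticToContinuum.Crystallization.Theorems.FrustratedLawDichotomyAveragingCut
open Summit.AtomisticToContinuum.Crystallization.Theorems.FrustratedLawDichotomyAveragingRuleCap
open Summit.AtomisticToContinuum.Crystallization.Theorems.FrustratedLawDichotomyAveragingRuleTightFree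
open Summit.AtomisticToContinuum.Crystallization.Theorems.FrustratedLawDichotomyStrainedPatchHomSplit
open Summit.AtomisticToContinuum.Crystallization.Theorems.FrustratedLawDichotomyStrainedPatchCleanCollar
open Summit.AtomisticToContinuum.Crystallization.Theorems.FrustratedLawDichotomyStrainedPatchHomIsometry
open Summit.AtomisticToContinuum.Crystallization.Theorems.FrustratedLawDichotomyStrainedPatchHomTubeIso
open Summit.AtomisticToContinuum.Crystallization.Theorems.FrustratedLawDichotomyStrainedPatchPhaseCut
open Summit.AtomisticToContinuum.Crystallization.Theorems.FrustratedLawDichotomyStrainedPatchCoreTube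
open Summit.AtomisticToContinuum.Crystallization.Theorems.FrustratedLawDichotomyStrainedPatchCoreTubeRecord
open Summit.AtomisticToContinuum.Crystallization.Theorems.FrustratedLawDichotomyStrainedPatchStrainBands
open Summit.AtomisticToContinuum.Crystallization.Theorems.FrustratedLawDichotomyStrainedPatchChartFamilies
open Summit.AtomisticToContinuum.Crystallization.Theorems.FrustratedLawDichotomyStrainedPatchChartFamiliesBent
open Summit.AtomisticToContinuum.Crystallization.Theorems.FrustratedLawDichotomyStrainedPatchChartFamiliesPinned
open Summit.AtomisticToContinuum.Crystallization.Theorems.FrustratedLawDichotomyStrainedPatchEnvelopeLaw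
open Summit.AtomisticToContinuum.Crystallization.Theorems.FrustratedLawDichotomyStrainedPatchEnvelopeTaylor
open Summit.AtomisticToContinuum.Crystallization.Theorems.FrustratedLawDichotomyStrainedPatchWindowFamilies
open Summit.AtomisticToContinuum.Crystallization.Theorems.FrustratedLawDichotomyStrainedPatchRecutPairs
open Summit.AtomisticToContinuum.Crystallization.Theorems.FrustratedLawDichotomyStrainedPatchMembership
open Summit.AtomisticToContinuum.Crystallization.Theorems.FrustratedLawDichotomyStrainedPatchDirect
open Summit.AtomisticToContinuum.Crystallization.Theorems.FrustratedLawDichotomyStrainedPatchTaylorPairSigned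
open Summit.AtomisticToContinuum.Crystallization.Theorems.FrustratedLawDichotomyStrainedPatchTaylorKbandMinus
open Summit.AtomisticToContinuum.Crystallization.Theorems.FrustratedLawDichotomyStrainedPatchTaylorKbandMinusD
open Summit.AtomisticToContinuum.Crystallization.Theorems.FrustratedLawDichotomyNashForceBalance (hasFDerivAt_lennardJones_dist)
open Summit.AtomisticToContinuum.Crystallization.Theorems.FrustratedLawDichotomyStrainedPatchQuantSlaving

/-! ## §1. (FMC) — the finite-move cap, by unfolding non-exemption -/

/-- ★ **(FMC) the FINITE-MOVE CAP.**  At a reach site `a` of an admissible cluster, moving `a` to any trial point `p` with `dist p (z a) ≤ s < 7/10`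
(`0 ≤ s ≤ 3/2`) cannot lower its move-test local field by more than `s·(7/(7−s))⁷·σ₁`:
`locField 7 z a (z a) ≤ locField 7 z a p + s·(7/(7−s))⁷·σ₁`.  Literally `¬MoveUnstableCore 0 7 s` at `a`, which `¬ExemptNear (9/5) ExRec z c` grants because a
reach site is within `9/2` of a `9/5`-member. [formal bookkeeping — definitional unfolding] -/
theorem finiteMoveCap {M : ℕ} {z : Fin M → E3} {c : Fin M} (hz : Admissible M z c) {a : Fin M} (ha : IsReach z c a)
    {s : ℝ} (hs₀ : 0 ≤ s) (hs : s ≤ 3 / 2) {p : E3} (hp : dist p (z a) ≤ s) (hp' : dist p (z a) < 7 / 10) :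
    locField 7 z a (z a) ≤ locField 7 z a p + s * (7 / (7 - s)) ^ 7 * sigmaOne := by
  obtain ⟨j, hj, hd⟩ := ha
  exact not_lt.1 fun hlt =>
    hz.2.2.2.2.1 ⟨j, hj, a, mem_ball.2 hd, Or.inl ⟨s, hs₀, hs, Or.inl ⟨p, hp, hp', by rw [zero_add]; exact hlt⟩⟩⟩

/-- (FMC) at the largest admissible radius of the move test: for `dist p (z a) < 7/10` one may take `s = dist p (z a)`. [formal bookkeeping] -/
theorem finiteMoveCap_dist {M : ℕ} {z : Fin M → E3} {c : Fin M} (hz : Admissible M z c) {a : Fin M} (ha : IsReach z c a)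
    {p : E3} (hp' : dist p (z a) < 7 / 10) :
    locField 7 z a (z a) ≤ locField 7 z a p + dist p (z a) * (7 / (7 - dist p (z a))) ^ 7 * sigmaOne :=
  finiteMoveCap hz ha dist_nonneg (by linarith) le_rfl hp'

/-! ## §2. (FC σ₁) — the force cap, as the `s → 0⁺` slope of (FMC) -/

/-- Move neighbours are distinct points from the site (injectivity of an admissible cluster). [formal bookkeeping] -/
theorem ne_of_mem_moveNbrs {M : ℕ} {z : Fin M → E3} (hinj : Function.Injective z) {a k : Fin M} {Rm : ℝ}
    (hk : k ∈ moveNbrs Rm z a) : z a ≠ z k := by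
  simp only [moveNbrs, Finset.mem_filter, Finset.mem_erase] at hk
  exact fun h => hk.1.1 (hinj h).symm

/-- ★ The move-test local field is Fréchet-differentiable at the site, with derivative `⟨−siteForce, ·⟩`:
`D(locField Rm z a)(z a) = ⟨Σ_k (V'(r_ak)/r_ak)·(z a − z k), ·⟩` for an injective configuration. [KNOWN-MATH — chain rule on a finite sum] -/
theorem hasFDerivAt_locField {M : ℕ} {z : Fin M → E3} (hinj : Function.Injective z) (a : Fin M) (Rm : ℝ) :
    HasFDerivAt (locField Rm z a) (innerSL ℝ (-siteForce Rm z a)) (z a) := by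
  have h1 : HasFDerivAt (fun q : E3 => ∑ k ∈ moveNbrs Rm z a, lennardJones (dist q (z k)))
      (∑ k ∈ moveNbrs Rm z a, (ljD1 (dist (z a) (z k)) / dist (z a) (z k)) • innerSL ℝ (z a - z k)) (z a) := by
    refine HasFDerivAt.fun_sum fun k hk => ?_
    refine (hasFDerivAt_lennardJones_dist (ne_of_mem_moveNbrs hinj hk)).congr_fderiv ?_
    congr 1
    rw [ljD1, div_eq_mul_inv]
    ring
  refine h1.congr_fderiv ?_
  ext u
  simp [siteForce]

/-- ★★ **(FC σ₁) PROVED: `ForceCapOne`** — every reach site of an admissible cluster obeys `‖siteForce 7 z a‖ ≤ σ₁`. [KNOWN-MATH, M — closed] -/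
theorem forceCapOne : ForceCapOne := by
  intro M z c hz a ha
  set w : E3 := -siteForce 7 z a with hw
  have hsf : siteForce 7 z a = -w := by rw [hw, neg_neg]
  rw [hsf, norm_neg]
  have hderiv : HasFDerivAt (locField 7 z a) (innerSL ℝ w) (z a) := hasFDerivAt_locField hz.1 a 7
  have hO := hasFDerivAt_iff_isLittleO_nhds_zero.1 hderiv
  -- the directional bound: `⟨w, v⟩ ≤ σ₁` for every unit vector `v`
  have hcap : ∀ v : E3, ‖v‖ = 1 → inner ℝ w v ≤ sigmaOne := by
    intro v hv
    refine le_of_forall_pos_lt_add fun ε hε => ?_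
    have hφ : Tendsto (fun t : ℝ => -(t • v)) (𝓝 0) (𝓝 0) := by
      have hc : Continuous fun t : ℝ => -(t • v) := by fun_prop
      simpa using hc.tendsto 0
    have h1t := hφ.eventually (Asymptotics.isLittleO_iff.1 hO (half_pos hε))
    have hg : Tendsto (fun t : ℝ => (7 / (7 - t)) ^ 7 * sigmaOne) (𝓝 0) (𝓝 sigmaOne) := by
      have hc : ContinuousAt (fun t : ℝ => (7 / (7 - t)) ^ 7 * sigmaOne) 0 :=
        ((continuousAt_const.div (continuousAt_const.sub continuousAt_id) (by norm_num)).pow 7).mul continuousAt_const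
      have h := hc.tendsto
      convert h using 2
      norm_num
    have h2t : ∀ᶠ t : ℝ in 𝓝 0, (7 / (7 - t)) ^ 7 * sigmaOne < sigmaOne + ε / 2 :=
      hg.eventually (gt_mem_nhds (by linarith : sigmaOne < sigmaOne + ε / 2))
    have h3t : ∀ᶠ t : ℝ in 𝓝 0, t < 7 / 10 := gt_mem_nhds (by norm_num)
    have h4t : ∀ᶠ t : ℝ in 𝓝[>] 0, 0 < t := eventually_nhdsWithin_of_forall fun t ht => ht
    obtain ⟨t, ht1, ht2, ht3, ht0⟩ :=
      ((h1t.filter_mono nhdsWithin_le_nhds).and ((h2t.filter_mono nhdsWithin_le_nhds).and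
        ((h3t.filter_mono nhdsWithin_le_nhds).and h4t))).exists
    have hnorm : ‖-(t • v)‖ = t := by
      rw [norm_neg, norm_smul, Real.norm_eq_abs, abs_of_pos ht0, hv, mul_one]
    have hdist : dist (z a + -(t • v)) (z a) = t := by rw [dist_eq_norm, add_sub_cancel_left, hnorm]
    -- (FMC) at radius `t` and trial point `z a − t v`
    have hB := finiteMoveCap hz ha ht0.le (by linarith) hdist.le (by linarith)
    -- the first-order expansion at `z a − t v`
    have hC : locField 7 z a (z a + -(t • v)) - locField 7 z a (z a) + t * inner ℝ w v ≤ ε / 2 * t := by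
      have h : ‖locField 7 z a (z a + -(t • v)) - locField 7 z a (z a) - (innerSL ℝ w) (-(t • v))‖ ≤ ε / 2 * ‖-(t • v)‖ := ht1
      rw [hnorm, innerSL_apply_apply, inner_neg_right, real_inner_smul_right, Real.norm_eq_abs] at h
      have h' := (le_abs_self _).trans h
      linarith
    have hD := mul_lt_mul_of_pos_left ht2 ht0
    have hE : t * inner ℝ w v < t * (sigmaOne + ε) := by linarith
    exact lt_of_mul_lt_mul_left hE ht0.le
  by_cases hw0 : w = 0
  · rw [hw0, norm_zero]; exact sigmaOne_pos.le
  · have hn0 : ‖w‖ ≠ 0 := norm_ne_zero_iff.2 hw0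
    have hv : ‖‖w‖⁻¹ • w‖ = 1 := by rw [norm_smul, norm_inv, norm_norm, inv_mul_cancel₀ hn0]
    have h := hcap _ hv
    rw [real_inner_smul_right, real_inner_self_eq_norm_sq, pow_two, ← mul_assoc, inv_mul_cancel₀ hn0, one_mul] at h
    exact h

/-- (FC σ) for every `σ ≥ σ₁`. [formal bookkeeping] -/
theorem forceCapLaw_of_le {σ : ℝ} (hσ : sigmaOne ≤ σ) : ForceCapLaw σ := forceCapLaw_mono hσ forceCapOne

/-- ★ The force cap as a plain inequality (the form the census instruments quote). -/
theorem norm_siteForce_le {M : ℕ} {z : Fin M → E3} {c : Fin M} (hz : Admissible M z c) {a : Fin M} (ha : IsReach z c a) :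
    ‖siteForce 7 z a‖ ≤ sigmaOne :=
  forceCapOne M z c hz a ha

/-! ## §3. The g57 records with the (FC) binder DISCHARGED -/

/-- ★ (TFR κσ₁) ⟹ (ENC κ): `slavingEnclosure_of_forceCap` with (FC σ₁) supplied. -/
theorem slavingEnclosure_of_taylor {𝓘 : ChartFam} {τ δ : ℝ} {T : LawTab} {κ : ℝ} {H : HessTab} {F : ForceTab} {X : SlackTab}
    (hT : ForceTaylorBound 𝓘 τ δ T (κ * sigmaOne) H F X) : SlavingEnclosure 𝓘 τ δ T κ sigmaOne H F X :=
  slavingEnclosure_of_forceCap forceCapOne hT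

/-- ★ (TFR-in κ (κ'σ₁)) ⟹ (STEP κ κ'): `remainderStep_of_forceCap` with (FC σ₁) supplied. -/
theorem remainderStep_of_taylorIn {𝓘 : ChartFam} {τ δ : ℝ} {T : LawTab} {κ κ' : ℝ} {H : HessTab} {F : ForceTab} {X : SlackTab}
    (hT : ForceTaylorBoundIn 𝓘 τ δ T κ sigmaOne (κ' * sigmaOne) H F X) : RemainderStep 𝓘 τ δ T sigmaOne H F X κ κ' :=
  remainderStep_of_forceCap forceCapOne hT

/-- ★★★★ **THE CHAIN RECORD `coreOff_record_g58c ηP k n`** — `coreOff_record_g57c` with its `(hFC : ForceCapOne)` binder DISCHARGED by `forceCapOne`: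
[CORE-FAR] ⟸ (BASᴾ-fix) · (MEMᴾ-fix μ) · (TFRᴾ ((k 0)·σ₁)) · the `n` steps (TFR-inᴾ (k i) ((k (i+1))·σ₁)) · (NEEDCERTᴾ (k n) Ψ) · (F1-law on `𝓘₀ꟴ`) · (F2-bent₀) · (F3ᴰ) ·
[BRIDGE] · [SOFT-FAR].  One open binder fewer than the g57 chain record; every remaining binder keeps its g57 tag. [folklore] -/
theorem coreOff_record_g58c (ηP : ℝ) (k : ℕ → ℝ) (n : ℕ) {H : HessTab} {F : ForceTab} {X : SlackTab} {Ψ : ModTab} {μ : LawTab}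
    (hBP : BasinFix (ClassP ηP) tau0 delta0 T0) (hMP : MembershipFix (ClassP ηP) tau0 delta0 T0 μ)
    (hT0 : ForceTaylorBound (ClassP ηP) tau0 delta0 T0 (k 0 * sigmaOne) H F X)
    (hSt : ∀ i : ℕ, i < n → ForceTaylorBoundIn (ClassP ηP) tau0 delta0 T0 (k i) sigmaOne (k (i + 1) * sigmaOne) H F X)
    (hNP : NeedCert (ClassP ηP) tau0 delta0 T0 (k n) sigmaOne H F X G0 wMinus Ψ) (hQ : FamilyEnvelopeLaw (ClassQ ηP) tau0 T0 (withColumns Ψ μ))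
    (hR : FamilyRoomBent0) (hC : FamilyCertD (withColumns Ψ μ)) (hBand : BandFarFloor (63 / 10) (63 / 10) (24 / 5) (1 / 100) (3 / 50) (1 / 10) 0)
    (hS : SoftFarFloor (63 / 10) (63 / 10) (24 / 5) (1 / 100) (1 / 10) 0) : CoreOffTubeFloor (63 / 10) (63 / 10) (24 / 5) (1 / 100) 0 :=
  coreOff_record_g57c ηP k n hBP hMP forceCapOne hT0 hSt hNP hQ hR hC hBand hS

end Summit.AtomisticToContinuum.Crystallization.Theorems.FrustratedLawDichotomyStrainedPatchForceCap
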